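import Summits.CriticalPhenomena.PercolationContinuityZ3.Theorems.PercNearOneGluingNoHeavyQuantLightPairCatHull
import HarnessLib

/-!
# QUANT lane R8, T-DEC: THE LIGHT GLUED PAIR ON THE CENSUS DIAGONAL `s = 1/2` — hypothesis-free membership for every `c ≥ 2` and every
# `q ∈ [(2c+2)/(2c+3), 1)` (census-2 g76; sequel of `…QuantLightPairCatHull`, variant `C` of the closed-form certificate)

builds on p205010 (kernel theorem, internal audit signed; external expert review pending)

Support file (`--supports stmt-CriticalPhenomena-4575`), QUANT lane census seat prim-quant-census-2 (gen 76), rung R8 of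
`run/shared/lean/prim/quant/LADDER.md`.  Closed-form real definitions and theorems; standard axioms, no sorries.

WHAT.  The second closed form for `T = (R¹[q](R^c[s]))²` at floor `y = qs`: the same columns `A, E, B, Z` as in `…QuantLightPairCatHull` and, for
the atom `c + 1`, the blob forest `C = δ_{c+1} ∗ Bern(p)`, `p = 2q(1+cs) − c − 1` (valid iff `qs ≤ p`), with weights `W_X = 2q(1−q)s/(1 − p)` and
`W_E, W_B, W_Z` by the same formulas (`lpT_inGatedCatHull_C`, explicit region `R_C(c)`).  ON THE CENSUS DIAGONAL `s = 1/2` (the lane's regression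
family `(R¹[q](R^c[1/2]))²`, floor `q/2 ↑ 1/2`; census-2 g75's hardest light pairs) everything is explicit:
  `W_A = 1 − q`, `W_X = q/(c+2)`, `W_E = 1/2 − q/(c+2)`, `W_Z = 2(1−q)²(c+1)/(c(3q−2))`, `W_B = (2q−1)/2 − W_Z`,
and ALL side conditions reduce to `q ≥ (2c+2)/(2c+3)`: **`lpT_half_inGatedCatHull : 2 ≤ c → (2c+2)/(2c+3) ≤ q → q < 1 →
InGatedCatHull (q/2) (2q + qc) (2c+2) (R¹[q](R^c[1/2]))²`** — hypothesis-free, every `c ≥ 2`, with `SDEC` and the every-floor / tree-built-presentation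
corollaries.  (Exact scan, census-2 g76: on `s = 1/2` the certificate is valid for `q ∈ [(2c+2)/(2c+3), 1)` and for no smaller `q`; e.g. `c = 3`:
`q ≥ 8/9`, covering the census instances `(R¹[.9](R³[.5]))²`, `(R¹[.97](R³[.5]))²` of the certificate pack.)
HONEST STATUS.  Instances (a one-parameter family per `c` on the diagonal; a region for variant `C`); `TreeBuiltCatHullLight`, `CatPairLight`,
`SiblingStep`, `FarTreeRow` remain OPEN; RATE class log\* / honest sentence of `run/shared/lean/prim/quant/README.md` unchanged.  [this work];
census: prim-quant-census-2 g75/g76.  Nothing here is cited as a published result.  The gluing rows served [cite: KozmaNitzan2024, Conjecture 3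
(p. 15)]; product measure [cite: Grimmett1999, §1.3 p. 10].
-/

noncomputable section

open scoped BigOperators

namespace Summit.CriticalPhenomena.PercolationContinuityZ3.Theorems
namespace Quant
namespace LawDec

open Finset

/-! ### Variant `C`: the atom-`c` column is the blob forest `δ_{c+1} ∗ Bern(p)` -/

/-- `C`'s Bernoulli parameter `p = 2q(1+cs) − c − 1` (so that `c + 1 + p = 2q(1+cs)`). [this work] -/
def lpPC (c : ℕ) (q s : ℝ) : ℝ := 2 * q * (1 + c * s) - c - 1

/-- `C`'s atom-`(c+1)` mass `1 − p = c + 2 − 2q(1+cs)`. [this work] -/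
def lpXcC (c : ℕ) (q s : ℝ) : ℝ := c + 2 - 2 * q * (1 + c * s)

/-- the five-column mixture with the `C` atom-`c` column. [this work] -/
def lpMixC (c : ℕ) (q s : ℝ) : ℕ → ℝ := fun h =>
  (1 - q) * gate (lpColA c s) q h + lpWE q s (lpXcC c q s) * lpColE c (lpGE c q s) h +
    lpWB c q s (lpXcC c q s) * lpColB c (2 * q - 1) (q * s / (2 * q - 1)) h +
    lpWZ c q s (lpXcC c q s) * lpColZ c (lpA1 c q s) (q * s / lpA1 c q s) h +
    lpWX q s (lpXcC c q s) * lpColC c (lpPC c q s) h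

/-- value form of the `C` mixture (coefficients collected per atom). [this work] -/
theorem lpMixC_apply (c : ℕ) (q s : ℝ) (h : ℕ) :
    lpMixC c q s h =
      (1 - q) * (1 - q) * pointLaw 0 h +
      (lpWB c q s (lpXcC c q s) * (1 - (2 * q - 1)) + lpWZ c q s (lpXcC c q s) * (1 - lpA1 c q s)) * pointLaw 1 h +
      ((1 - q) * q * (1 - s) ^ 2 + lpWE q s (lpXcC c q s) * (1 - lpGE c q s) +
          lpWB c q s (lpXcC c q s) * ((2 * q - 1) * (1 - q * s / (2 * q - 1)))) * pointLaw 2 h +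
      (lpWX q s (lpXcC c q s) * (1 - lpPC c q s)) * pointLaw (c + 1) h +
      ((1 - q) * q * (2 * s * (1 - s)) + lpWE q s (lpXcC c q s) * lpGE c q s +
          lpWZ c q s (lpXcC c q s) * (lpA1 c q s * (1 - q * s / lpA1 c q s)) +
          lpWX q s (lpXcC c q s) * lpPC c q s) * pointLaw (c + 2) h +
      ((1 - q) * q * s ^ 2 + lpWB c q s (lpXcC c q s) * ((2 * q - 1) * (q * s / (2 * q - 1))) +
          lpWZ c q s (lpXcC c q s) * (lpA1 c q s * (q * s / lpA1 c q s))) * pointLaw (2 * c + 2) h := by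
  simp only [lpMixC, gate, lpColA_apply, lpColE_apply, lpColB_apply, lpColZ_apply, lpColC_apply]
  rw [gate_ite_eq_pointLaw]
  ring

/-- coefficient check at atom `1` (variant `C`). [this work] -/
theorem lpMixC_coeff1 (c : ℕ) (q s : ℝ) (hc0 : (c : ℝ) ≠ 0) (hD1 : 2 * q - 1 - q * s ≠ 0) (hX : c + 2 - 2 * q * (1 + c * s) ≠ 0) :
    lpWB c q s (lpXcC c q s) * (1 - (2 * q - 1)) + lpWZ c q s (lpXcC c q s) * (1 - lpA1 c q s) = 2 * q * (1 - q) * (1 - s) := by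
  have hc1 : (c : ℝ) + 1 ≠ 0 := by positivity
  simp only [lpWZ, lpWB, lpWE, lpWX, lpXcC, lpGE, lpA1]
  generalize eD1 : 2 * q - 1 - q * s = D1 at hD1 ⊢
  generalize eX : (c : ℝ) + 2 - 2 * q * (1 + c * s) = X at hX ⊢
  field_simp
  subst eD1 eX
  ring

/-- coefficient check at atom `2` (variant `C`). [this work] -/
theorem lpMixC_coeff2 (c : ℕ) (q s : ℝ) (hc0 : (c : ℝ) ≠ 0) (hb : 2 * q - 1 ≠ 0) (hD1 : 2 * q - 1 - q * s ≠ 0)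
    (hX : c + 2 - 2 * q * (1 + c * s) ≠ 0) :
    (1 - q) * q * (1 - s) ^ 2 + lpWE q s (lpXcC c q s) * (1 - lpGE c q s) +
        lpWB c q s (lpXcC c q s) * ((2 * q - 1) * (1 - q * s / (2 * q - 1))) = q ^ 2 * (1 - s) ^ 2 := by
  simp only [lpWB, lpWE, lpWX, lpXcC, lpGE]
  generalize eD1 : 2 * q - 1 - q * s = D1 at hD1 ⊢
  generalize eX : (c : ℝ) + 2 - 2 * q * (1 + c * s) = X at hX ⊢
  generalize eB : 2 * q - 1 = B at hb eD1 ⊢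
  field_simp
  subst eB eD1 eX
  ring

/-- coefficient check at atom `c + 1` (variant `C`). [this work] -/
theorem lpMixC_coeffc1 (c : ℕ) (q s : ℝ) (hX : c + 2 - 2 * q * (1 + c * s) ≠ 0) :
    lpWX q s (lpXcC c q s) * (1 - lpPC c q s) = 2 * q * (1 - q) * s := by
  simp only [lpWX, lpXcC, lpPC]
  rw [show (1 : ℝ) - (2 * q * (1 + c * s) - c - 1) = c + 2 - 2 * q * (1 + c * s) by ring, div_mul_cancel₀ _ hX]

/-- coefficient check at atom `c + 2` (variant `C`). [this work] -/
theorem lpMixC_coeffc2 (c : ℕ) (q s : ℝ) (hc0 : (c : ℝ) ≠ 0) (hD1 : 2 * q - 1 - q * s ≠ 0) (hD3 : 2 * q - 1 + c * (q * s) ≠ 0)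
    (hX : c + 2 - 2 * q * (1 + c * s) ≠ 0) :
    (1 - q) * q * (2 * s * (1 - s)) + lpWE q s (lpXcC c q s) * lpGE c q s +
        lpWZ c q s (lpXcC c q s) * (lpA1 c q s * (1 - q * s / lpA1 c q s)) +
        lpWX q s (lpXcC c q s) * lpPC c q s = 2 * q ^ 2 * s * (1 - s) := by
  have hc1 : (c : ℝ) + 1 ≠ 0 := by positivity
  simp only [lpWZ, lpWB, lpWE, lpWX, lpXcC, lpGE, lpA1, lpPC]
  generalize eD1 : 2 * q - 1 - q * s = D1 at hD1 ⊢
  generalize eD3 : 2 * q - 1 + (c : ℝ) * (q * s) = D3 at hD3 ⊢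
  generalize eX : (c : ℝ) + 2 - 2 * q * (1 + c * s) = X at hX ⊢
  field_simp
  subst eD1 eD3 eX
  ring

/-- coefficient check at atom `2c + 2` (variant `C`). [this work] -/
theorem lpMixC_coefftop (c : ℕ) (q s : ℝ) (hb : 2 * q - 1 ≠ 0) (hD3 : 2 * q - 1 + c * (q * s) ≠ 0) :
    (1 - q) * q * s ^ 2 + lpWB c q s (lpXcC c q s) * ((2 * q - 1) * (q * s / (2 * q - 1))) +
        lpWZ c q s (lpXcC c q s) * (lpA1 c q s * (q * s / lpA1 c q s)) = q ^ 2 * s ^ 2 := by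
  have hc1 : (c : ℝ) + 1 ≠ 0 := by positivity
  have hA : lpA1 c q s ≠ 0 := by simp only [lpA1]; exact div_ne_zero hD3 hc1
  have e1 : (2 * q - 1) * (q * s / (2 * q - 1)) = q * s := by field_simp
  have e2 : lpA1 c q s * (q * s / lpA1 c q s) = q * s := by field_simp
  rw [e1, e2, lpWZ]
  ring

/-- **THE CLOSED-FORM CERTIFICATE IDENTITY (variant `C`)**, pointwise, off the poles. [this work] -/
theorem lpT_eq_mixC (c : ℕ) (q s : ℝ) (hc0 : (c : ℝ) ≠ 0) (hb : 2 * q - 1 ≠ 0) (hD1 : 2 * q - 1 - q * s ≠ 0)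
    (hD3 : 2 * q - 1 + c * (q * s) ≠ 0) (hX : c + 2 - 2 * q * (1 + c * s) ≠ 0) (h : ℕ) : lpT c q s h = lpMixC c q s h := by
  rw [lpT_apply, lpMixC_apply]
  linear_combination (-(pointLaw 1 h)) * lpMixC_coeff1 c q s hc0 hD1 hX + (-(pointLaw 2 h)) * lpMixC_coeff2 c q s hc0 hb hD1 hX +
    (-(pointLaw (c + 1) h)) * lpMixC_coeffc1 c q s hX + (-(pointLaw (c + 2) h)) * lpMixC_coeffc2 c q s hc0 hD1 hD3 hX +
    (-(pointLaw (2 * c + 2) h)) * lpMixC_coefftop c q s hb hD3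

/-- the certificate data (variant `C`): weights. [this work] -/
def lpWC (c : ℕ) (q s : ℝ) : Fin 5 → ℝ :=
  ![1 - q, lpWE q s (lpXcC c q s), lpWB c q s (lpXcC c q s), lpWZ c q s (lpXcC c q s), lpWX q s (lpXcC c q s)]

/-- the certificate data (variant `C`): column laws. [this work] -/
def lpPCv (c : ℕ) (q s : ℝ) : Fin 5 → ℕ → ℝ :=
  ![lpColA c s, lpColE c (lpGE c q s), lpColB c (2 * q - 1) (q * s / (2 * q - 1)), lpColZ c (lpA1 c q s) (q * s / lpA1 c q s),
    lpColC c (lpPC c q s)]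

/-- **MEMBERSHIP, variant `C`**, on the explicit region `R_C(c)` (`hC`: `qs ≤ p`; weights nonnegative). [this work] -/
theorem lpT_inGatedCatHull_C (c : ℕ) (q s : ℝ) (hc : 1 ≤ c) (hq : 1 / 2 < q) (hq1 : q < 1) (hs0 : 0 < s) (hs1 : s < 1)
    (hy : q * s < 1 / 2) (hE : 2 * (1 - q) ≤ c * (q * s)) (hB : q * s < 2 * q - 1) (hC : q * s ≤ 2 * q * (1 + c * s) - c - 1)
    (hWE : 0 ≤ lpWE q s (lpXcC c q s)) (hWB : 0 ≤ lpWB c q s (lpXcC c q s)) (hWZ : 0 ≤ lpWZ c q s (lpXcC c q s)) :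
    InGatedCatHull (q * s) (2 * q * (1 + c * s)) (2 * c + 2) (lpT c q s) := by
  have hcR : (1 : ℝ) ≤ c := by exact_mod_cast hc
  have hc0 : (c : ℝ) ≠ 0 := by positivity
  have hq0 : 0 < q := by linarith
  have hy0 : 0 < q * s := mul_pos hq0 hs0
  have hy1 : q * s < 1 := by linarith
  have hb0 : 0 < 2 * q - 1 := by linarith
  have hD1 : 0 < 2 * q - 1 - q * s := by linarith
  have hD3 : 0 < 2 * q - 1 + c * (q * s) := by nlinarith
  have hcs : c * (q * s) < c * (1 / 2 : ℝ) := by nlinarith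
  have hX : 0 < (c : ℝ) + 2 - 2 * q * (1 + c * s) := by nlinarith
  have hWX : 0 ≤ lpWX q s (lpXcC c q s) := by
    unfold lpWX lpXcC; exact div_nonneg (by nlinarith) hX.le
  have hgE0 : q * s ≤ lpGE c q s := by
    have : 2 * (1 - q) / (c : ℝ) ≤ q * s := by rw [div_le_iff₀ (by positivity)]; nlinarith
    unfold lpGE; linarith
  have hgE1 : lpGE c q s ≤ 1 := by
    unfold lpGE; have : 0 ≤ 2 * (1 - q) / (c : ℝ) := by positivity
    linarith
  have hA1y : q * s < lpA1 c q s := by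
    unfold lpA1; rw [lt_div_iff₀ (by positivity)]; nlinarith
  have hA11 : lpA1 c q s ≤ 1 := by
    unfold lpA1; rw [div_le_one (by positivity)]; nlinarith
  have hP0 : q * s ≤ lpPC c q s := by unfold lpPC; linarith
  have hP1 : lpPC c q s ≤ 1 := by unfold lpPC; nlinarith
  refine ⟨Fin 5, inferInstance, lpWC c q s, lpS q, lpN c, lpPCv c q s, ?_, ?_, ?_, ?_, ?_, ?_, fun h => ?_⟩
  · intro i
    fin_cases i
    · show 0 ≤ 1 - q; linarith
    · exact hWE
    · exact hWB
    · exact hWZ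
    · exact hWX
  · rw [Fin.sum_univ_five]
    show (1 - q) + lpWE q s (lpXcC c q s) + lpWB c q s (lpXcC c q s) + lpWZ c q s (lpXcC c q s) + lpWX q s (lpXcC c q s) = 1
    simp only [lpWE, lpWZ]; ring
  · intro i
    fin_cases i
    · show q * s < q ∧ q ≤ 1; exact ⟨by nlinarith, hq1.le⟩
    all_goals exact ⟨hy1, le_rfl⟩
  · intro i
    fin_cases i
    · show CatBuilt (q * s / q) (2 * c + 2) (lpColA c s)
      rw [mul_div_cancel_left₀ s hq0.ne']; exact cat_lpColA c s hs0 hs1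
    · show CatBuilt (q * s / 1) (c + 2) (lpColE c (lpGE c q s))
      rw [div_one]; exact cat_lpColE c (q * s) _ hy0 hy1 hgE0 hgE1
    · show CatBuilt (q * s / 1) (2 * c + 2) (lpColB c (2 * q - 1) (q * s / (2 * q - 1)))
      rw [div_one]; exact cat_lpColB c (q * s) _ hy0 hB (by linarith)
    · show CatBuilt (q * s / 1) (2 * c + 2) (lpColZ c (lpA1 c q s) (q * s / lpA1 c q s))
      rw [div_one]; exact cat_lpColZ c (q * s) _ hy0 hA1y hA11
    · show CatBuilt (q * s / 1) (c + 2) (lpColC c (lpPC c q s))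
      rw [div_one]; exact cat_lpColC c (q * s) _ hy0 hy1 hP0 hP1
  · intro i
    fin_cases i
    · show 2 * c + 2 ≤ 2 * c + 2; exact le_rfl
    · show c + 2 ≤ 2 * c + 2; omega
    · show 2 * c + 2 ≤ 2 * c + 2; exact le_rfl
    · show 2 * c + 2 ≤ 2 * c + 2; exact le_rfl
    · show c + 2 ≤ 2 * c + 2; omega
  · intro i
    fin_cases i
    · exact lpColA_mean c q s
    · show (1 : ℝ) * ∑ h ∈ Finset.range (c + 2 + 1), (h : ℝ) * lpColE c (lpGE c q s) h = 2 * q * (1 + c * s)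
      rw [lpColE_mean]; unfold lpGE; field_simp; ring
    · show (1 : ℝ) * ∑ h ∈ Finset.range (2 * c + 2 + 1), (h : ℝ) * lpColB c (2 * q - 1) (q * s / (2 * q - 1)) h = 2 * q * (1 + c * s)
      rw [lpColB_mean, mul_div_cancel₀ _ hb0.ne']; ring
    · show (1 : ℝ) * ∑ h ∈ Finset.range (2 * c + 2 + 1), (h : ℝ) * lpColZ c (lpA1 c q s) (q * s / lpA1 c q s) h = 2 * q * (1 + c * s)
      rw [lpColZ_mean, mul_div_cancel₀ _ (hy0.trans hA1y).ne']
      unfold lpA1; field_simp; ring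
    · show (1 : ℝ) * ∑ h ∈ Finset.range (c + 2 + 1), (h : ℝ) * lpColC c (lpPC c q s) h = 2 * q * (1 + c * s)
      rw [lpColC_mean]; unfold lpPC; ring
  · rw [Fin.sum_univ_five, lpT_eq_mixC c q s hc0 hb0.ne' hD1.ne' hD3.ne' hX.ne' h]
    show lpMixC c q s h = (1 - q) * gate (lpColA c s) q h + lpWE q s (lpXcC c q s) * gate (lpColE c (lpGE c q s)) 1 h +
      lpWB c q s (lpXcC c q s) * gate (lpColB c (2 * q - 1) (q * s / (2 * q - 1))) 1 h +
      lpWZ c q s (lpXcC c q s) * gate (lpColZ c (lpA1 c q s) (q * s / lpA1 c q s)) 1 h +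
      lpWX q s (lpXcC c q s) * gate (lpColC c (lpPC c q s)) 1 h
    simp only [lpMixC, gate_one]

/-! ### The census diagonal `s = 1/2`: everything explicit, hypothesis-free for `q ≥ (2c+2)/(2c+3)` -/

/-- on the diagonal, `W_E = 1/2 − q/(c+2)`. [this work] -/
theorem lpWE_half (c : ℕ) (q : ℝ) (hX : (c : ℝ) + 2 - 2 * q * (1 + c * (1 / 2)) ≠ 0) :
    lpWE q (1 / 2) (lpXcC c q (1 / 2)) = 1 / 2 - q / (c + 2) := by
  have hc2 : (c : ℝ) + 2 ≠ 0 := by positivity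
  have e : (c : ℝ) + 2 - 2 * q * (1 + c * (1 / 2)) = (c + 2) * (1 - q) := by ring
  simp only [lpWE, lpWX, lpXcC]
  rw [e] at hX ⊢
  have h1q : (1 : ℝ) - q ≠ 0 := fun h0 => hX (by rw [h0, mul_zero])
  field_simp
  ring

/-- on the diagonal, `W_Z = 2(1−q)²(c+1)/(c(3q−2))`. [this work] -/
theorem lpWZ_half (c : ℕ) (q : ℝ) (hc0 : (c : ℝ) ≠ 0) (hq1 : q ≠ 1) (h32 : 3 * q - 2 ≠ 0) :
    lpWZ c q (1 / 2) (lpXcC c q (1 / 2)) = 2 * (1 - q) ^ 2 * (c + 1) / (c * (3 * q - 2)) := by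
  have hc2 : (c : ℝ) + 2 ≠ 0 := by positivity
  have h1q : (1 : ℝ) - q ≠ 0 := sub_ne_zero.2 (Ne.symm hq1)
  have eX : (c : ℝ) + 2 - 2 * q * (1 + c * (1 / 2)) = (c + 2) * (1 - q) := by ring
  have eD : 2 * q - 1 - q * (1 / 2) = (3 * q - 2) / 2 := by ring
  simp only [lpWZ, lpWB, lpWE, lpWX, lpXcC, lpGE]
  rw [eX, eD]
  generalize eG : 3 * q - 2 = G at h32 ⊢
  generalize eH : 1 - q = H at h1q ⊢
  field_simp
  subst eG eH
  ring

/-- **THE LIGHT GLUED PAIR ON THE CENSUS DIAGONAL IS IN THE GATED CATERPILLAR HULL — EVERY `c ≥ 2`, EVERY `q ∈ [(2c+2)/(2c+3), 1)`, NO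
OTHER HYPOTHESIS**: `InGatedCatHull (q/2) (2q(1 + c/2)) (2c+2) (R¹[q](R^c[1/2]))²`. [this work] -/
theorem lpT_half_inGatedCatHull (c : ℕ) (q : ℝ) (hc : 2 ≤ c) (hq : (2 * c + 2) / (2 * c + 3) ≤ q) (hq1 : q < 1) :
    InGatedCatHull (q * (1 / 2)) (2 * q * (1 + c * (1 / 2))) (2 * c + 2) (lpT c q (1 / 2)) := by
  have hcR : (2 : ℝ) ≤ c := by exact_mod_cast hc
  have hc0 : (c : ℝ) ≠ 0 := by positivity
  have hε : (1 - q) * (2 * c + 3) ≤ 1 := by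
    have h := (div_le_iff₀ (by positivity : (0 : ℝ) < 2 * c + 3)).1 hq
    nlinarith
  have hq67 : 6 / 7 ≤ q := by nlinarith
  have h1q : 0 < 1 - q := by linarith
  have hX : 0 < (c : ℝ) + 2 - 2 * q * (1 + c * (1 / 2)) := by nlinarith
  refine lpT_inGatedCatHull_C c q (1 / 2) (by omega) (by linarith) hq1 (by norm_num) (by norm_num) (by linarith) (by nlinarith)
    (by linarith) (by nlinarith) ?_ ?_ ?_
  · rw [lpWE_half c q hX.ne', sub_nonneg, div_le_iff₀ (by positivity)]; nlinarith
  · have hZ := lpWZ_half c q hc0 hq1.ne (by linarith)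
    have eB : lpWB c q (1 / 2) (lpXcC c q (1 / 2)) = (2 * q - 1) * (1 / 2) - lpWZ c q (1 / 2) (lpXcC c q (1 / 2)) := by
      simp only [lpWZ]; ring
    rw [eB, hZ, sub_nonneg, div_le_iff₀ (by nlinarith)]
    have A : 20 / 49 * (c : ℝ) ≤ (2 * q - 1) * (3 * q - 2) * c := by
      have : (20 : ℝ) / 49 ≤ (2 * q - 1) * (3 * q - 2) := by nlinarith
      nlinarith
    have B : (1 - q) ^ 2 ≤ 1 / 49 := by
      have : 1 - q ≤ 1 / 7 := by nlinarith
      nlinarith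
    nlinarith
  · rw [lpWZ_half c q hc0 hq1.ne (by linarith)]
    exact div_nonneg (by positivity) (by nlinarith)

/-- … at every floor `0 < x ≤ q/2` (the node's binder reaches these laws exactly there), mean as the law's first moment. [this work] -/
theorem lpT_half_inGatedCatHull_below (c : ℕ) (q : ℝ) (hc : 2 ≤ c) (hq : (2 * c + 2) / (2 * c + 3) ≤ q) (hq1 : q < 1)
    (x : ℝ) (hx0 : 0 < x) (hx : x ≤ q * (1 / 2)) :
    InGatedCatHull x (∑ h ∈ Finset.range (2 * c + 2 + 1), (h : ℝ) * lpT c q (1 / 2) h) (2 * c + 2) (lpT c q (1 / 2)) := by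
  rw [lpT_mean]
  exact (lpT_half_inGatedCatHull c q hc hq hq1).mono hx0 hx

/-- **SDEC on the diagonal**, no oracle: `SDEC (q/2) (2c+2) (R¹[q](R^c[1/2]))²` for `c ≥ 2`, `(2c+2)/(2c+3) ≤ q < 1`. [this work] -/
theorem sdec_lpT_half (c : ℕ) (q : ℝ) (hc : 2 ≤ c) (hq : (2 * c + 2) / (2 * c + 3) ≤ q) (hq1 : q < 1) :
    SDEC (q * (1 / 2)) (2 * c + 2) (lpT c q (1 / 2)) := by
  have hcR : (2 : ℝ) ≤ c := by exact_mod_cast hc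
  have : 0 < q := by
    have h := (div_le_iff₀ (by positivity : (0 : ℝ) < 2 * c + 3)).1 hq
    nlinarith
  exact sdec_of_inGatedCatHull (by positivity) (lpT_half_inGatedCatHull c q hc hq hq1)

end LawDec
end Quant
end Summit.CriticalPhenomena.PercolationContinuityZ3.Theorems
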